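import Summits.AtomisticToContinuum.FouriersLaw.Theorems.EmbeddedDrudeMourreFGRGapBranchA

/-!
# `EmbeddedDrudeMourre.MourreDissolution`, line `swap-odd-threshold-rigidity` — registered stub A
# `stub_pairThreshold`: rigidity of the frequency-0 threshold of the free pair resonance

Item `stmt-AtomisticToContinuum-12594` (crux `MourreDissolution` of route `EmbeddedDrudeMourre`, sub-problem
`FouriersLaw`), line `swap-odd-threshold-rigidity`, stub A (the card's first lemma `PairThresholdOnDiagonal`).

On the `(2,2)` zero-momentum shell a zero of the resonance function
`Ω(k₁,k₂,k₃) = ω(k₁) + ω(k₂) − ω(k₃) − ω(k₁+k₂−k₃)` at which all four group velocities coincide lies on the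
exchange diagonal `k₃ ≡ k₁` or `k₃ ≡ k₂ (mod 2π)`. The proof is the two-root algebra of the FGRGap line
(`FGRGap.FoldJetRigidity.Branch.modEq_of_velocity_eq`, file `…FGRGapBranchA`): off the diagonal `k₃ − k₁ ∉ 2πℤ`
a zero `k₂` of `Ω(k₁, ·, k₃)` with `∂₂Ω = v(k₂) − v(k₁+k₂−k₃) = 0` is congruent to every zero, in particular to
the exchange zero `k₃` (`resonanceFn_self`). Only `Ω = 0`, `v₂ = v₃` and `v₃ = v₄` are used (`v₁ = v₂` is idle).
-/

noncomputable section

namespace Summit.AtomisticToContinuum.FouriersLaw.Theorems.MourreDissolution.SwapOddThresholdRigidity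

open Real
open Literature.MathematicalPhysics.KineticTheory.PhononBoltzmann
open Summit.AtomisticToContinuum.FouriersLaw.Theorems.FGRGap.FoldJetRigidity.Branch

/-- **Stub A of line swap-odd-threshold-rigidity (`stub_pairThreshold`): rigidity of the frequency-0
threshold.** For `ω₂ > 0`, a zero of `Ω(k₁,k₂,k₃)` with `v(k₁) = v(k₂) = v(k₃) = v(k₁+k₂−k₃)`
(`v = groupVelocity ω₂ = ω'`) has `k₃ ≡ k₁` or `k₃ ≡ k₂ (mod 2π)`: the level-0 critical set of the free pair
resonance (co-moving collisions) lies on the exchange diagonal, where every collision bracket vanishes.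
[cite: AokiLukkarinenSpohn2006, eqs. (4.2)-(4.8)] [cite: Lukkarinen2016, §2.2.4 and §3.4] -/
theorem stub_pairThreshold :
    ∀ ω₂ : ℝ, 0 < ω₂ → ∀ k₁ k₂ k₃ : ℝ,
      Literature.MathematicalPhysics.KineticTheory.PhononBoltzmann.resonanceFn ω₂ k₁ k₂ k₃ = 0 →
      Literature.MathematicalPhysics.KineticTheory.PhononBoltzmann.groupVelocity ω₂ k₁ =
      Literature.MathematicalPhysics.KineticTheory.PhononBoltzmann.groupVelocity ω₂ k₂ →
      Literature.MathematicalPhysics.KineticTheory.PhononBoltzmann.groupVelocity ω₂ k₂ =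
      Literature.MathematicalPhysics.KineticTheory.PhononBoltzmann.groupVelocity ω₂ k₃ →
      Literature.MathematicalPhysics.KineticTheory.PhononBoltzmann.groupVelocity ω₂ k₃ =
      Literature.MathematicalPhysics.KineticTheory.PhononBoltzmann.groupVelocity ω₂ (k₁ + k₂ - k₃) → (∃ n :
      ℤ, k₃ = k₁ + 2 * Real.pi * n) ∨ (∃ n : ℤ, k₃ = k₂ + 2 * Real.pi * n) := by
  intro ω₂ hω k₁ k₂ k₃ hΩ _h12 h23 h34
  by_cases hdiag : ∃ n : ℤ, k₃ - k₁ = n * (2 * π)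
  · obtain ⟨n, hn⟩ := hdiag
    exact Or.inl ⟨n, by linarith⟩
  · push Not at hdiag
    have hv : groupVelocity ω₂ k₂ = groupVelocity ω₂ (k₁ + k₂ - k₃) := h23.trans h34
    obtain ⟨n, hn⟩ := modEq_of_velocity_eq hω hdiag hΩ (resonanceFn_self ω₂ k₁ k₃) hv
    exact Or.inr ⟨n, by linarith⟩

end Summit.AtomisticToContinuum.FouriersLaw.Theorems.MourreDissolution.SwapOddThresholdRigidity

end
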